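import Summits.FinalStateConjecture.FinalStateConjecture.Theorems.SwallowTheDatumKerrShieldedSettlesStubKerrLeafSojourn
import Summits.FinalStateConjecture.FinalStateConjecture.Theorems.SwallowTheDatumKerrShieldedSettlesStubScriTransportAux
import Literature.Geometry.Lorentzian.NullInfinityConstSmul
import HarnessLib

/-!
# Crux `PhaseMixingCapture.CaptureSufficesC2` (stmt-FinalStateConjecture-14986), line `Sketch`,
# stub `stub_softShieldedScri` — support file 4: the FOOT of a normalised ray on the flat leaf

Clause (P4) of the LEAF PACKAGE of `stub_softShieldedScri` (module docstring of
`…StubSoftShieldedScriAssembly.lean`) asks for the foot on the flat leaf `{t* = 0}` of every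
normalised null ray issued from a far point of the bent data slice `{t* = T_{M,a}(r)}`; inside the
realised exact Kerr region this is a statement about the ingoing Kerr–Schild chart
`(Kerr.region a M, g_{M,a})` alone, proved here (`stub_softShieldedScri_sandwichFoot`): for `M ≥ 0`,
`|a| < M`, the bent leaf `graph M a M` with a future unit normal field `ν` and a leaf point `y`,
`‖y‖ ≥ 34M + 2|a| + 4`, every normalised future null ray `γ : dom` of the chart from `graph M a M y`
extends to the PAST down to the flat leaf at a parameter `−t₀ ≤ 0`, `[−t₀, 0] ⊆ dom`, with
`x⁰ > 0` on `(−t₀, 0]`, spatial displacement `≤ T(r(y))`, radius `≥ 16M + 2`, `x⁰ < T(r)` on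
`[−t₀, 0)`, `0 < γ̇⁰(−t₀) ≤ 7` and `−7 ≤ g(γ̇(−t₀), n)` for the future unit normal `n` of the flat leaf.
Proof (Dafermos–Rodnianski arXiv:0811.0354, §5.1, run backwards): the Killing energy is conserved and
pinned, `0 < E ≤ 5` (`KerrLeafSojourn.energy_pos_le_five`); on `{r ≥ 16M}` a null velocity of energy
`E` has `4E/5 ≤ γ̇⁰ ≤ 7`, `|γ̇⃗| ≤ γ̇⁰` (`ks_null_energy_far`), so backwards the coordinate time
decreases at rate `≥ 4E/5` while the displacement is bounded by the elapsed coordinate time;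
CONTINUATION on the set `G` of past parameters `t` with `[t, 0] ⊆ dom`, `r ≥ 16M`, `x⁰ ≥ 0` along
`[t, 0]`: its infimum lies in `dom` (escape lemma `not_bddAbove_of_tangentLift_mem` for the REVERSED
maximal geodesic, O'Neill 1983, Ch. 5, Lemma 8), belongs to `G` by continuity, and carries `x⁰ = 0`
(openness of `dom`); the clock `u = x⁰ − T(r)` increases along the future causal ray
(`ScriTransport.strictMonoOn_u`); at the foot `g(γ̇, n) = −(1 + 2H)^{-1/2} γ̇⁰ ∈ [−7, 0)` (Cook 2000,
§3.2.2).  References: Dafermos–Rodnianski arXiv:0811.0354, §5.1; O'Neill 1983, Ch. 5, Lemma 8,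
Ch. 14, p. 415; Cook, Living Rev. Relativ. 3 (2000) 5, §3.2.2.
-/

set_option linter.dupNamespace false

noncomputable section

open Set Filter MeasureTheory Metric
open scoped Manifold ContDiff Topology
open Literature.Geometry.Lorentzian
open Summit.FinalStateConjecture.FinalStateConjecture.Theorems.KerrShieldedDataExist.Negative
  (bentHeight graph coe_graph mass_pos rPlus_le_two_mul)
open Summit.FinalStateConjecture.FinalStateConjecture.Theorems.StarvedNecks.OneOverDelta.FarEnd
  (ks_null_energy_far)
open Summit.FinalStateConjecture.FinalStateConjecture.Theorems.StarvedNecks.OneOverDelta.Escape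
  (not_bddAbove_of_tangentLift_mem isCompact_setOf_tangent)
open Summit.FinalStateConjecture.FinalStateConjecture.Theorems.SwallowTheDatum.KerrShieldedSettles
  (CollarCauchy.velocity_eq_deriv CollarCauchy.bentHeight_nonneg CollarCauchy.bentHeight_le_half_add
    ScriTransport.strictMonoOn_u)
open Summit.FinalStateConjecture.FinalStateConjecture.Theorems.SwallowTheDatum.KerrShieldedSettles.KerrLeafSojourn
  (ray_hasDerivAt ray_energy_eq ray_null_eq ray_far_bounds energy_pos_le_five spatialNorm_sub_le_radius
    norm_spatial_sub_le_time_sub hasDerivAt_time_coord norm_le_two_mul_of_spatial_le norm_sub_le_mul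
    ray_isFutureCausalCurveOn scalarH_le_inv)

namespace Summit.FinalStateConjecture.FinalStateConjecture.Theorems.CaptureSufficesC2.Sketch

namespace SoftShieldedScri

namespace SandwichFoot

section Kinematics

variable {c v : ℝ → E4} {s : Set ℝ}

/-- **Elapsed coordinate time is at least `κ ×` affine time** when `κ ≤ (v t)⁰` on `s` (mean value
inequality). [folklore] -/
theorem mul_sub_le_time_sub (hs : s.OrdConnected) (hc : ∀ t ∈ s, HasDerivAt c (v t) t) {κ : ℝ}
    (hκ : ∀ t ∈ s, κ ≤ v t 0) {σ₁ σ₂ : ℝ} (h₁ : σ₁ ∈ s) (h₂ : σ₂ ∈ s) (h12 : σ₁ ≤ σ₂) :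
    κ * (σ₂ - σ₁) ≤ c σ₂ 0 - c σ₁ 0 := by
  have hd : ∀ t ∈ s, HasDerivAt (fun σ ↦ c σ 0) (v t 0) t := fun t ht ↦ hasDerivAt_time_coord hc ht
  exact hs.convex.mul_sub_le_image_sub_of_le_deriv
    (fun t ht ↦ (hd t ht).continuousAt.continuousWithinAt)
    (fun t ht ↦ (hd t (interior_subset ht)).differentiableAt.differentiableWithinAt)
    (fun t ht ↦ by rw [(hd t (interior_subset ht)).deriv]; exact hκ t (interior_subset ht))
    σ₁ h₁ σ₂ h₂ h12

end Kinematics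

section Ray

variable [Kerr.Facts] {M a : ℝ} [(Kerr.smoothMetric M a M).HasLeviCivita]
  {γ : ℝ → Kerr.region a M} {dom : Set ℝ}

/-- **Far bounds along a null geodesic with energy `E ∈ (0, 5]`, with the lower rate.** At a
parameter where `r ≥ 16M` (`H ≤ 1/16`): the coordinate curve is differentiable there and its chart
velocity `v = γ̇` satisfies `4E/5 ≤ v⁰ ≤ 7`, `0 < v⁰` and `‖v⃗‖ ≤ v⁰` (`ks_null_energy_far` with the
conserved energy `E = E(0)`, `KerrLeafSojourn.ray_far_bounds`). [cite: arXiv08110354, §5.1] -/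
theorem ray_far_bounds' (hM : 0 ≤ M) (hopen : IsOpen dom) (hoc : dom.OrdConnected)
    (hgeo : IsGeodesicOn (Kerr.smoothMetric M a M).leviCivita γ dom) (h0 : (0 : ℝ) ∈ dom)
    (hnull : Kerr.bilin M a (γ 0) (deriv (fun σ ↦ (γ σ : E4)) 0) (deriv (fun σ ↦ (γ σ : E4)) 0) = 0)
    (hE : 0 < -Kerr.bilin M a (γ 0) (deriv (fun σ ↦ (γ σ : E4)) 0) (E4.basisVector 0))
    (hE5 : -Kerr.bilin M a (γ 0) (deriv (fun σ ↦ (γ σ : E4)) 0) (E4.basisVector 0) ≤ 5)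
    {t : ℝ} (ht : t ∈ dom) (hr : 16 * M ≤ Kerr.radius a (γ t)) :
    HasDerivAt (fun σ ↦ (γ σ : E4)) (deriv (fun σ ↦ (γ σ : E4)) t) t ∧
      0 < deriv (fun σ ↦ (γ σ : E4)) t 0 ∧
      ‖E4.spatial (deriv (fun σ ↦ (γ σ : E4)) t)‖ ≤ deriv (fun σ ↦ (γ σ : E4)) t 0 ∧
      deriv (fun σ ↦ (γ σ : E4)) t 0 ≤ 7 ∧
      4 / 5 * (-Kerr.bilin M a (γ 0) (deriv (fun σ ↦ (γ σ : E4)) 0) (E4.basisVector 0)) ≤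
        deriv (fun σ ↦ (γ σ : E4)) t 0 := by
  obtain ⟨hv0, hsp, h7⟩ := ray_far_bounds hM hopen hoc hgeo h0 hnull hE hE5 ht hr
  refine ⟨(ray_hasDerivAt hgeo ht).1, hv0, hsp, h7, ?_⟩
  have hx : 0 < Kerr.radius a (γ t) := Kerr.radius_pos_of_mem_region (γ t).2
  have hH : Kerr.scalarH M a (γ t) ≤ 1 / 16 := scalarH_le_inv hM a hx (by norm_num) hr
  have hnull' : Kerr.bilin M a (γ t) (deriv (fun σ ↦ (γ σ : E4)) t)
      (deriv (fun σ ↦ (γ σ : E4)) t) = 0 := by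
    rw [ray_null_eq hopen hoc hgeo ht h0, hnull]
  have hEt : -Kerr.bilin M a (γ t) (deriv (fun σ ↦ (γ σ : E4)) t) (E4.basisVector 0) =
      -Kerr.bilin M a (γ 0) (deriv (fun σ ↦ (γ σ : E4)) 0) (E4.basisVector 0) := by
    rw [ray_energy_eq hopen hoc hgeo ht h0]
  obtain ⟨-, -, -, h54⟩ := ks_null_energy_far hM hx hH hnull' (by rw [hEt]; exact hE)
  rw [hEt] at h54
  linarith

omit [Kerr.Facts] [(Kerr.smoothMetric M a M).HasLeviCivita] in
/-- **The pairing with the flat-leaf normal.**  For the future unit normal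
`n = (1 + 2H)^{-1/2} V` of the Kerr–Schild slice `{t* = 0}` (`Kerr.sliceNormal`, `V = −g♯dt*`) at a
chart point `x = (0, z)` and any vector `w` with `0 < w⁰ ≤ 7`: `−7 ≤ g(w, n)`, since
`g(w, n) = −(1 + 2H)^{-1/2} w⁰` (`Kerr.bilin_timeVector`) and `1 + 2H ≥ 1` for `M ≥ 0`.
Cook, Living Rev. Relativ. 3 (2000) 5, §3.2.2. [cite: Cook2000, §3.2.2] -/
theorem neg_seven_le_bilin_sliceNormal (hM : 0 ≤ M) (x : Kerr.region a M) (z : Kerr.slice a M)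
    (hxz : E4.ofTimeSpace 0 (z : E3) = (x : E4)) {w : E4} (hw0 : 0 < w 0) (hw7 : w 0 ≤ 7) :
    -(7 : ℝ) ≤ Kerr.bilin M a x w (Kerr.sliceNormal M a M z) := by
  have hx : 0 < Kerr.radius a (x : E4) := Kerr.radius_pos_of_mem_region x.2
  have hH := Kerr.scalarH_nonneg hM a (x : E4)
  rw [Kerr.sliceNormal_apply, hxz, map_smul, smul_eq_mul, Kerr.bilin_symm, Kerr.bilin_timeVector hx]
  set S : ℝ := √(1 + 2 * Kerr.scalarH M a (x : E4)) with hS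
  have hS1 : 1 ≤ S := by
    rw [hS]
    exact Real.one_le_sqrt.2 (by linarith)
  have hSinv : S⁻¹ ≤ 1 := inv_le_one_of_one_le₀ hS1
  have hSinv0 : 0 ≤ S⁻¹ := inv_nonneg.2 (zero_le_one.trans hS1)
  nlinarith [mul_le_mul hSinv hw7 hw0.le zero_le_one]

end Ray

end SandwichFoot

open SandwichFoot

/-- **Registered sub-goal `stub_softShieldedScri_sandwichFoot` of stub `stub_softShieldedScri`**
(line `Sketch`, crux stmt-FinalStateConjecture-14986): **the foot on the flat leaf of a normalised
ray from the far bent slice** (pure Kerr–Schild chart; see the module docstring).  For `M ≥ 0`,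
`|a| < M`, a future unit normal field `ν` of the bent leaf `graph M a M` and a leaf point `y` with
`‖y‖ ≥ 34M + 2|a| + 4`, every normalised future null ray `γ : dom` of `g_{M,a}` from `graph M a M y`
has `t₀ ≥ 0` with `[−t₀, 0] ⊆ dom`, `x⁰(γ(−t₀)) = 0`, `x⁰ > 0` on `(−t₀, 0]`,
`‖γ⃗(t) − y‖ ≤ T(r(0, y))` and `r(γ t) ≥ 16M + 2` on `[−t₀, 0]`, `x⁰(γ t) < T(r(γ t))` on `[−t₀, 0)`,
`0 < γ̇⁰(−t₀) ≤ 7` (chart velocity `γ̇ = deriv (γ : E4)`, `CollarCauchy.velocity_eq_deriv`), and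
`−7 ≤ g(γ̇(−t₀), n)` for the flat-leaf normal `n = Kerr.sliceNormal` at the foot.
[cite: arXiv08110354, §5.1] -/
theorem stub_softShieldedScri_sandwichFoot : ∀ [Kerr.Facts] (M a : ℝ) (hM : 0 ≤ M), |a| < M → ∀ (ν : NormalField 𝓘(ℝ, E4) (graph M a M)), (Kerr.smoothMetric M a M).IsFutureUnitNormal 𝓘(ℝ, E3) ((Kerr.timeOrientation M a M hM).ofLE le_top) (graph M a M) ν → ∀ [(Kerr.smoothMetric M a M).HasLeviCivita] (y : Kerr.slice a M), 34 * M + 2 * |a| + 4 ≤ ‖(y : E3)‖ → ∀ (γ : ℝ → Kerr.region a M) (dom : Set ℝ), (Kerr.smoothMetric M a M).IsNormalisedNullRayFrom ((Kerr.timeOrientation M a M hM).ofLE le_top) (graph M a M) ν y γ dom → ∃ t₀ : ℝ, 0 ≤ t₀ ∧ Set.Icc (-t₀) 0 ⊆ dom ∧ (γ (-t₀) : E4) 0 = 0 ∧ (∀ t ∈ Set.Ioc (-t₀) 0, 0 < (γ t : E4) 0) ∧ (∀ t ∈ Set.Icc (-t₀) 0, ‖E4.spatial (γ t : E4) - (y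 : E3)‖ ≤ bentHeight M a (Kerr.radius a (E4.ofTimeSpace 0 (y : E3)))) ∧ (∀ t ∈ Set.Icc (-t₀) 0, 16 * M + 2 ≤ Kerr.radius a (γ t : E4)) ∧ (∀ t ∈ Set.Ico (-t₀) 0, (γ t : E4) 0 < bentHeight M a (Kerr.radius a (γ t : E4))) ∧ 0 < deriv (fun σ ↦ (γ σ : E4)) (-t₀) 0 ∧ deriv (fun σ ↦ (γ σ : E4)) (-t₀) 0 ≤ 7 ∧ ∀ z : Kerr.slice a M, E4.ofTimeSpace 0 (z : E3) = (γ (-t₀) : E4) → -(7 : ℝ) ≤ Kerr.bilin M a (γ (-t₀)) (deriv (fun σ ↦ (γ σ : E4)) (-t₀)) (Kerr.sliceNormal M a M z) :=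
  fun M a hM ha ν hν _ y hy γ dom hray ↦ by
    have hMp := mass_pos ha
    have habs : 0 ≤ |a| := abs_nonneg a
    have hmax := hray.isMaximalGeodesicOn
    have hopen : IsOpen dom := hmax.isOpen
    have hoc : dom.OrdConnected := hmax.2.1
    have hgeo := hmax.isGeodesicOn
    have h0 : (0 : ℝ) ∈ dom := hray.zero_mem
    have hγ0 : γ 0 = graph M a M y := hray.apply_zero
    have hv := fun t ↦ CollarCauchy.velocity_eq_deriv γ t
    have hnull : Kerr.bilin M a (γ 0) (deriv (fun σ ↦ (γ σ : E4)) 0)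
        (deriv (fun σ ↦ (γ σ : E4)) 0) = 0 := by
      have h := hray.isNull_velocity.1; rwa [Kerr.smoothMetric_val, hv 0] at h
    have hfd : 0 < deriv (fun σ ↦ (γ σ : E4)) 0 0 := by
      have h : Kerr.bilin M a (γ 0) (Kerr.timeVector M a (γ 0)) (velocity 𝓘(ℝ, E4) γ 0) < 0 :=
        hray.isFutureDirected_velocity.2
      rw [Kerr.bilin_timeVector (Kerr.radius_pos_of_mem_region (γ 0).2), hv 0] at h
      linarith
    have hnorm : Kerr.bilin M a (graph M a M y) (deriv (fun σ ↦ (γ σ : E4)) 0) (ν y) = -1 := by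
      have h := hray.val_velocity_normal; rwa [Kerr.smoothMetric_val, hv 0] at h
    have hy16 : 16 * M + |a| + 1 ≤ ‖(y : E3)‖ := by linarith
    obtain ⟨hE, hE5⟩ := energy_pos_le_five ha hM hν y hy16 (by rw [← hγ0]; exact hnull) hfd hnorm
    rw [← hγ0] at hE hE5
    set E : ℝ := -Kerr.bilin M a (γ 0) (deriv (fun σ ↦ (γ σ : E4)) 0) (E4.basisVector 0) with hE_def
    have hE0 : Kerr.bilin M a (γ 0) (deriv (fun σ ↦ (γ σ : E4)) 0) (E4.basisVector 0) ≠ 0 := by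
      intro h; rw [hE_def, h] at hE; simp at hE
    set κ : ℝ := 4 / 5 * E with hκ_def
    have hκ : 0 < κ := by positivity
    set T₀ : ℝ := (γ 0 : E4) 0 with hT₀_def
    have hstart0 : T₀ = bentHeight M a (Kerr.radius a (E4.ofTimeSpace 0 (y : E3))) := by
      rw [hT₀_def, hγ0, coe_graph, E4.ofTimeSpace_apply_zero]
    have hstartsp : E4.spatial (γ 0 : E4) = (y : E3) := by rw [hγ0, coe_graph, E4.spatial_ofTimeSpace]
    have hT₀0 : 0 ≤ T₀ := by rw [hstart0]; exact CollarCauchy.bentHeight_nonneg ha _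
    have hT₀1 : T₀ ≤ ‖(y : E3)‖ / 2 + M := by
      rw [hstart0]
      have := CollarCauchy.bentHeight_le_half_add ha
        (Kerr.radius_nonneg a (E4.ofTimeSpace 0 (y : E3)))
      linarith [(Kerr.radius_le_spatialNorm a _).trans_eq (E4.spatialNorm_ofTimeSpace 0 (y : E3))]
    have hyT : T₀ + 16 * M + |a| + 2 ≤ ‖(y : E3)‖ := by linarith
    have hfb : ∀ t ∈ dom, 16 * M ≤ Kerr.radius a (γ t) →
        HasDerivAt (fun σ ↦ (γ σ : E4)) (deriv (fun σ ↦ (γ σ : E4)) t) t ∧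
        0 < deriv (fun σ ↦ (γ σ : E4)) t 0 ∧
        ‖E4.spatial (deriv (fun σ ↦ (γ σ : E4)) t)‖ ≤ deriv (fun σ ↦ (γ σ : E4)) t 0 ∧
        deriv (fun σ ↦ (γ σ : E4)) t 0 ≤ 7 ∧ κ ≤ deriv (fun σ ↦ (γ σ : E4)) t 0 :=
      fun t ht hr ↦ ray_far_bounds' hM hopen hoc hgeo h0 hnull hE hE5 ht hr
    set G : Set ℝ := {t : ℝ | t ≤ 0 ∧ Icc t 0 ⊆ dom ∧
      ∀ u ∈ Icc t 0, 16 * M ≤ Kerr.radius a (γ u) ∧ 0 ≤ (γ u : E4) 0} with hG_def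
    have hr0 : 16 * M + 2 ≤ Kerr.radius a (γ 0) := by
      have h := spatialNorm_sub_le_radius a (γ 0 : E4)
      rw [show E4.spatialNorm (γ 0 : E4) = ‖E4.spatial (γ 0 : E4)‖ from rfl, hstartsp] at h
      linarith
    have h0G : (0 : ℝ) ∈ G := by
      refine ⟨le_rfl, fun u hu ↦ ?_, fun u hu ↦ ?_⟩
      · rw [le_antisymm hu.2 hu.1] ; exact h0
      · rw [le_antisymm hu.2 hu.1]; exact ⟨by linarith, hT₀0⟩
    have hGkin : ∀ t ∈ G, ∀ u ∈ Icc t 0,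
        κ * (0 - u) ≤ T₀ - (γ u : E4) 0 ∧
          ‖E4.spatial (γ u : E4) - (y : E3)‖ ≤ T₀ - (γ u : E4) 0 ∧
          16 * M + 2 ≤ Kerr.radius a (γ u) ∧
          ‖(γ u : E4) - (γ 0 : E4)‖ ≤ 2 * 7 * |u - 0| := by
      rintro t ⟨ht0, hI, hgood⟩ u hu
      have hIoc : (Icc t 0).OrdConnected := ordConnected_Icc
      have hder : ∀ u' ∈ Icc t 0, HasDerivAt (fun σ ↦ (γ σ : E4)) (deriv (fun σ ↦ (γ σ : E4)) u') u' :=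
        fun u' hu' ↦ (hfb u' (hI hu') (hgood u' hu').1).1
      have h0I : (0 : ℝ) ∈ Icc t 0 := ⟨ht0, le_rfl⟩
      have h1 : κ * (0 - u) ≤ T₀ - (γ u : E4) 0 :=
        mul_sub_le_time_sub hIoc hder (fun u' hu' ↦ (hfb u' (hI hu') (hgood u' hu').1).2.2.2.2)
          hu h0I hu.2
      have h2 : ‖E4.spatial (γ 0 : E4) - E4.spatial (γ u : E4)‖ ≤ (γ 0 : E4) 0 - (γ u : E4) 0 :=
        norm_spatial_sub_le_time_sub hIoc hder
          (fun u' hu' ↦ (hfb u' (hI hu') (hgood u' hu').1).2.2.1) hu h0I hu.2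
      rw [hstartsp, norm_sub_rev] at h2
      have h3 : 16 * M + 2 ≤ Kerr.radius a (γ u) := by
        have h := spatialNorm_sub_le_radius a (γ u : E4)
        rw [show E4.spatialNorm (γ u : E4) = ‖E4.spatial (γ u : E4)‖ from rfl] at h
        have h' : ‖(y : E3)‖ - ‖E4.spatial (γ u : E4)‖ ≤ ‖E4.spatial (γ u : E4) - (y : E3)‖ := by
          rw [norm_sub_rev]; exact norm_sub_norm_le _ _
        linarith [(hgood u hu).2]
      have h4 : ‖(γ u : E4) - (γ 0 : E4)‖ ≤ 2 * 7 * |u - 0| :=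
        norm_sub_le_mul hIoc hder (fun u' hu' ↦ (hfb u' (hI hu') (hgood u' hu').1).2.2.1)
          (fun u' hu' ↦ (hfb u' (hI hu') (hgood u' hu').1).2.2.2.1) h0I hu
      exact ⟨h1, h2, h3, h4⟩
    have hGbdd : ∀ t ∈ G, -(T₀ / κ) ≤ t := fun t ht ↦ by
      have h := (hGkin t ht t ⟨le_rfl, ht.1⟩).1
      have h'' := (le_div_iff₀ hκ).2 (show -t * κ ≤ T₀ by linarith [(ht.2.2 t ⟨le_rfl, ht.1⟩).2])
      linarith
    have hGup : ∀ t ∈ G, ∀ t' ∈ Icc t 0, t' ∈ G := fun t ht t' ht' ↦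
      ⟨ht'.2, fun u hu ↦ ht.2.1 ⟨ht'.1.trans hu.1, hu.2⟩, fun u hu ↦ ht.2.2 u ⟨ht'.1.trans hu.1, hu.2⟩⟩
    have hGne : G.Nonempty := ⟨0, h0G⟩
    have hGbdd' : BddBelow G := ⟨-(T₀ / κ), hGbdd⟩
    set tstar : ℝ := sInf G with htstar
    have htstar_le : ∀ t ∈ G, tstar ≤ t := fun t ht ↦ csInf_le hGbdd' ht
    have htstar0 : tstar ≤ 0 := htstar_le 0 h0G
    have hIoc_G : ∀ t', tstar < t' → t' ≤ 0 → t' ∈ G := fun t' h1 h2 ↦ by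
      obtain ⟨t, htG, htt'⟩ := exists_lt_of_csInf_lt hGne h1
      exact hGup t htG t' ⟨htt'.le, h2⟩
    haveI : CovariantDerivative.ContMDiffCovariantDerivative (Kerr.smoothMetric M a M).leviCivita 1 :=
      ⟨(Kerr.smoothMetric M a M).toPseudoRiemannianMetric.isLocallyContMDiff_leviCivita_holds 1
        (by rw [show ((1 : ℕ∞) : ℕ∞ω) + 1 = 2 by norm_num]; exact WithTop.coe_le_coe.2 le_top)
        univ isOpen_univ⟩
    have htstar_dom : tstar ∈ dom := by
      by_contra hnot
      have hdom_gt : ∀ t ∈ dom, tstar < t := fun t ht ↦ by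
        by_contra hle
        exact hnot (hoc.out ht h0 ⟨not_lt.1 hle, htstar0⟩)
      set γr : ℝ → Kerr.region a M := fun u ↦ γ ((-1 : ℝ) * u) with hγr
      set domr : Set ℝ := (fun u ↦ (-1 : ℝ) * u) ⁻¹' dom with hdomr
      have hmaxr : IsMaximalGeodesicOn (Kerr.smoothMetric M a M).leviCivita γr domr :=
        IsMaximalGeodesicOn.comp_mul hmax (by norm_num)
      have h0r : (0 : ℝ) ∈ domr := by show (-1 : ℝ) * 0 ∈ dom; rw [mul_zero]; exact h0
      have hbdd : BddAbove domr :=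
        ⟨-tstar, fun u hu ↦ by have h : tstar < (-1 : ℝ) * u := hdom_gt _ hu; linarith⟩
      set K : Set E4 := closedBall (γ 0 : E4) (2 * 7 * (T₀ / κ)) ∩
        Kerr.radius a ⁻¹' Ici (16 * M) with hK_def
      have hKc : IsCompact K :=
        (isCompact_closedBall _ _).inter_right (isClosed_Ici.preimage (Kerr.continuous_radius a))
      have hKU : K ⊆ (Kerr.region a M : Set E4) := fun z hz ↦ by
        have h16 : 16 * M ≤ Kerr.radius a z := hz.2
        show max M 0 < Kerr.radius a z
        rw [max_lt_iff]; constructor <;> linarith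
      have h𝒦 := isCompact_setOf_tangent (U := Kerr.region a M) hKc hKU (2 * 7)
      refine not_bddAbove_of_tangentLift_mem hmaxr h𝒦 h0r (fun u hu hu0 ↦ ?_) hbdd
      have hnegu : -u ∈ dom := by have h : (-1 : ℝ) * u ∈ dom := hu; rwa [neg_one_mul] at h
      have hmu : -u ∈ G := by
        rcases hu0.eq_or_lt with h | h
        · rw [← h, neg_zero]; exact h0G
        · exact hIoc_G (-u) (hdom_gt _ hnegu) (by linarith)
      obtain ⟨-, -, hr2, hdist⟩ := hGkin (-u) hmu (-u) ⟨le_rfl, by linarith⟩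
      have hb := hfb (-u) hnegu (by linarith)
      refine ⟨⟨?_, ?_⟩, ?_⟩
      · show ((γ ((-1 : ℝ) * u) : Kerr.region a M) : E4) ∈ closedBall (γ 0 : E4) (2 * 7 * (T₀ / κ))
        rw [neg_one_mul, mem_closedBall, dist_eq_norm]
        refine hdist.trans ?_
        have h1 : |-u - 0| ≤ T₀ / κ := by
          rw [sub_zero, abs_neg, abs_of_nonneg hu0]; linarith [hGbdd (-u) hmu]
        nlinarith [abs_nonneg (-u - 0)]
      · show 16 * M ≤ Kerr.radius a ((γ ((-1 : ℝ) * u) : Kerr.region a M) : E4)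
        rw [neg_one_mul]; linarith
      · have h : ‖deriv (fun σ ↦ (γ σ : E4)) (-u)‖ ≤ 2 * 7 :=
          (norm_le_two_mul_of_spatial_le hb.2.2.1).trans (by linarith [hb.2.2.2.1])
        have hvr : (velocity 𝓘(ℝ, E4) γr u : E4) =
            (-1 : ℝ) • (velocity 𝓘(ℝ, E4) γ ((-1 : ℝ) * u) : E4) := velocity_comp_mul γ (-1) u
        have hvr' : (show E4 from velocity 𝓘(ℝ, E4) γr u) = -(deriv (fun σ ↦ (γ σ : E4)) (-u)) := by
          rw [show (show E4 from velocity 𝓘(ℝ, E4) γr u) = (velocity 𝓘(ℝ, E4) γr u : E4) from rfl, hvr,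
            neg_one_mul, hv (-u), neg_one_smul]
          rfl
        show ‖(show E4 from velocity 𝓘(ℝ, E4) γr u)‖ ≤ 2 * 7
        rw [hvr', norm_neg]
        exact h
    have hIdom : Icc tstar 0 ⊆ dom := hoc.out htstar_dom h0
    have hcont : ContinuousAt (fun σ ↦ (γ σ : E4)) tstar :=
      (ray_hasDerivAt hgeo htstar_dom).1.continuousAt
    have hcont0 : ContinuousAt (fun σ ↦ (γ σ : E4) 0) tstar :=
      ((EuclideanSpace.proj (0 : Fin 4) : E4 →L[ℝ] ℝ).continuous.continuousAt).comp hcont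
    have hcontr : ContinuousAt (fun σ ↦ Kerr.radius a (γ σ : E4)) tstar :=
      ((Kerr.continuous_radius a).continuousAt).comp hcont
    have hright : ∀ t', tstar < t' → t' ≤ 0 →
        16 * M + 2 ≤ Kerr.radius a (γ t') ∧ 0 ≤ (γ t' : E4) 0 := fun t' h1 h2 ↦ by
      have hG' := hIoc_G t' h1 h2
      exact ⟨(hGkin t' hG' t' ⟨le_rfl, h2⟩).2.2.1, (hG'.2.2 t' ⟨le_rfl, h2⟩).2⟩
    have hstar : 16 * M + 2 ≤ Kerr.radius a (γ tstar) ∧ 0 ≤ (γ tstar : E4) 0 := by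
      rcases htstar0.eq_or_lt with h | h
      · rw [h]; exact ⟨hr0, hT₀0⟩
      · have hI : Ioo tstar 0 ∈ 𝓝[>] tstar := Ioo_mem_nhdsGT h
        have ht1 : Tendsto (fun σ ↦ Kerr.radius a (γ σ : E4)) (𝓝[>] tstar)
            (𝓝 (Kerr.radius a (γ tstar : E4))) := hcontr.tendsto.mono_left nhdsWithin_le_nhds
        have ht2 : Tendsto (fun σ ↦ (γ σ : E4) 0) (𝓝[>] tstar) (𝓝 ((γ tstar : E4) 0)) :=
          hcont0.tendsto.mono_left nhdsWithin_le_nhds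
        constructor
        · refine ge_of_tendsto ht1 ?_
          filter_upwards [hI] with t' ht' using (hright t' ht'.1 ht'.2.le).1
        · refine ge_of_tendsto ht2 ?_
          filter_upwards [hI] with t' ht' using (hright t' ht'.1 ht'.2.le).2
    have hstarG : tstar ∈ G := by
      refine ⟨htstar0, hIdom, fun u hu ↦ ?_⟩
      rcases hu.1.eq_or_lt with h | h
      · rw [← h]; exact ⟨by linarith [hstar.1], hstar.2⟩
      · exact ⟨by linarith [(hright u h hu.2).1], (hright u h hu.2).2⟩
    have hstar_x0 : (γ tstar : E4) 0 = 0 := by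
      by_contra hne
      have hpos : 0 < (γ tstar : E4) 0 := lt_of_le_of_ne hstar.2 (Ne.symm hne)
      obtain ⟨δ, hδ, hball⟩ := Metric.isOpen_iff.1 hopen tstar htstar_dom
      have h16 : 16 * M < Kerr.radius a (γ tstar : E4) := by linarith [hstar.1]
      have hev : ∀ᶠ t in 𝓝 tstar, 16 * M < Kerr.radius a (γ t : E4) ∧ 0 < (γ t : E4) 0 := by
        filter_upwards [hcontr.preimage_mem_nhds (Ioi_mem_nhds h16),
          hcont0.preimage_mem_nhds (Ioi_mem_nhds hpos)] with t h1 h2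
        exact ⟨h1, h2⟩
      obtain ⟨ε, hε, hεP⟩ := Metric.eventually_nhds_iff.1 hev
      set t₁ : ℝ := tstar - min (δ / 2) (ε / 2) with ht₁
      have hmin : 0 < min (δ / 2) (ε / 2) := lt_min (by linarith) (by linarith)
      have hminδε := And.intro (min_le_left (δ / 2) (ε / 2)) (min_le_right (δ / 2) (ε / 2))
      have ht₁G : t₁ ∈ G := by
        refine ⟨by linarith, fun u hu ↦ ?_, fun u hu ↦ ?_⟩
        · by_cases hut : u < tstar
          · refine hball ?_
            rw [mem_ball, Real.dist_eq, abs_lt]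
            constructor <;> linarith [hu.1, hminδε.1]
          · exact hIdom ⟨not_lt.1 hut, hu.2⟩
        · by_cases hut : u < tstar
          · obtain ⟨h1, h2⟩ := hεP (show dist u tstar < ε by
              rw [Real.dist_eq, abs_lt]; constructor <;> linarith [hu.1, hminδε.2])
            exact ⟨h1.le, h2.le⟩
          · exact hstarG.2.2 u ⟨not_lt.1 hut, hu.2⟩
      linarith [htstar_le t₁ ht₁G]
    have hfbI : ∀ u ∈ Icc tstar 0,
        HasDerivAt (fun σ ↦ (γ σ : E4)) (deriv (fun σ ↦ (γ σ : E4)) u) u ∧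
        0 < deriv (fun σ ↦ (γ σ : E4)) u 0 ∧
        ‖E4.spatial (deriv (fun σ ↦ (γ σ : E4)) u)‖ ≤ deriv (fun σ ↦ (γ σ : E4)) u 0 ∧
        deriv (fun σ ↦ (γ σ : E4)) u 0 ≤ 7 ∧ κ ≤ deriv (fun σ ↦ (γ σ : E4)) u 0 :=
      fun u hu ↦ hfb u (hIdom hu) (hstarG.2.2 u hu).1
    have hb := hfbI tstar ⟨le_rfl, htstar0⟩
    refine ⟨-tstar, by linarith, by rw [neg_neg]; exact hIdom, by rw [neg_neg]; exact hstar_x0,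
      fun t ht ↦ ?_, fun t ht ↦ ?_,
      fun t ht ↦ by rw [neg_neg] at ht; exact (hGkin tstar hstarG t ht).2.2.1, fun t ht ↦ ?_,
      by rw [neg_neg]; exact hb.2.1,
      by rw [neg_neg]; exact hb.2.2.2.1, fun z hz ↦ ?_⟩
    · rw [neg_neg] at ht
      have h := mul_sub_le_time_sub (ordConnected_Icc (a := tstar) (b := 0))
        (fun u hu ↦ (hfbI u hu).1) (fun u hu ↦ (hfbI u hu).2.2.2.2) ⟨le_rfl, htstar0⟩
        ⟨ht.1.le, ht.2⟩ ht.1.le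
      rw [hstar_x0] at h
      nlinarith [mul_pos hκ (sub_pos.2 ht.1)]
    · rw [neg_neg] at ht
      rw [← hstart0]
      linarith [(hstarG.2.2 t ht).2, (hGkin tstar hstarG t ht).2.1]
    · rw [neg_neg] at ht
      have hc := ray_isFutureCausalCurveOn hM hopen hoc hgeo h0 hnull hfd hE0 hIdom
      have hmono := ScriTransport.strictMonoOn_u ha (ordConnected_Icc (a := tstar) (b := 0)) hc
      have hlt := hmono ⟨ht.1, ht.2.le⟩ ⟨htstar0, le_rfl⟩ ht.2
      have hu0 : (γ 0 : E4) 0 - bentHeight M a (Kerr.radius a (γ 0 : E4)) = 0 := by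
        rw [hγ0, coe_graph, E4.ofTimeSpace_apply_zero,
          Kerr.radius_ofTimeSpace a (bentHeight M a (Kerr.radius a (E4.ofTimeSpace 0 (y : E3)))) (y : E3),
          sub_self]
      simp only at hlt
      linarith
    · rw [neg_neg] at hz ⊢
      exact neg_seven_le_bilin_sliceNormal hM (γ tstar) z hz hb.2.1 hb.2.2.2.1

end SoftShieldedScri

end Summit.FinalStateConjecture.FinalStateConjecture.Theorems.CaptureSufficesC2.Sketch

end
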